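import Mathlib
import Summits.ValiantsHypothesis.ValiantsHypothesis.Statement
import Summits.ValiantsHypothesis.ValiantsHypothesis.Theorems.SoloInformedBundleGirth
import HarnessLib

/-!
# Soloist (informed) rung: the ray girth bound — a dimension budget along one ray of the dendrogram (quadspan 2.67)

Session s35 of the soloist programme `solo-ValiantsHypothesis-informed`.

Setting of `soloInformed_bilinearGirth` / `soloInformed_bundleGirth`: nonzero columns
`u_i = (p i, q i)`, `i < L`, of polynomials over a field, `μ_i` = order of `u_i` at `0`,
`d(i,j)` = order of `det(u_i,u_j)`, classes `C_i(θ) = {x : d(i,x) ≥ θ + μ_i + μ_x}` (the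
`0`-dendrogram), and a set `E ⊂ ℕ` of exponents with `X^e ∝ det(u_i,u_j)`; such a target has LEVEL
`θ_e = e - μ_i - μ_j` and BRANCH CLASS `C_i(θ_e) = C_j(θ_e)` (`solo_bg_split`).

* `soloInformed_rayGirth` — fix a PROBE column `a`.  If every `e ∈ E` is realised by a pair whose
  branch class contains `a` (the branch node lies on the ray from the root to the leaf `a`), and
  `E` is `(K,h)`-free with `4k ≤ K`, `h ≥ 1`, then
  `|E| ≤ |R_a| + 86 k |V|^{1+1/k}`, where `V ⊇ {μ_i}` and `R_a ⊇ {ord det(u_a,u_x) : x}` is the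
  CONTACT PROFILE of the probe.
* `soloInformed_rayGirth_finrank` — if all entries lie in a subspace `W` of dimension `s`, then
  `|R_a| ≤ dim (p_a W + q_a W) ≤ 2s` and `|V| ≤ s`, so `|E| ≤ 2s + 86 k s^{1+1/k}`:
  the free target values whose branch nodes lie on ONE root-to-leaf ray of the dendrogram number
  `s^{1+o(1)}` (at `k ≈ log s`), for any number `L` of columns and all degrees.
* `SoloNatFree.anti` — subsets of free sets are free (so the bound applies to the ray part of any
  free `E`).

Proof.  If `a ∈ C_i(θ_e)` then by the Cramer ultrametric
`min (d(i,a) + μ_j) (d(a,j) + μ_i) ≤ d(i,j) + μ_a = e + μ_a`, while both terms are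
`≥ θ_e + μ_i + μ_j + μ_a = e + μ_a`; so one of them equals `e + μ_a`, i.e.
`e = (ord det(u_a,u_z) - μ_a) + μ_y` with `{y,z} = {i,j}`: `E ⊆ (R_a - μ_a) + V`, and the
asymmetric sumset girth bound `soloInformed_asymSumsetGirth` (s34) finishes.  The point is that
`R_a` is a set of orders of NONZERO ELEMENTS OF THE `2s`-DIMENSIONAL SPACE `p_a W + q_a W`, hence
has at most `2s` elements (`solo_card_le_finrank_of_orders`) — an algebraic level/order budget
coming from `dim W`, which the combinatorial bundle count of `soloInformed_bundleGirth`
(`≤ L ⌊log₂ L⌋` bundles) does not see.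

PATH TO THE SUMMIT / WHAT THIS DOES NOT DO.  The open statement of the line
(`soloInformed_valiantsHypothesis_of_unipolyLogOrderBound`, hypothesis `hQ`) needs `|E| ≤ C s^γ`,
`γ < 3/2`, for ALL free `E` realised in `span{b_j b_k}`; in the rank-2 (determinantal) model this
file bounds the part of `E` carried by any single ray by `s^{1+o(1)}`, so a rank-2 counterexample
must spread its targets over `≥ s^{1/2-o(1)}` rays (leaves of the subtree spanned by the rich
branch nodes) at the place `0` — and, by `t ↦ 1/t`, at `∞` — in every `GL₂`-gauge.  Path-like
("caterpillar") dendrograms are thereby excluded; bushy ones are not, and the conversion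
`n → s` (quadspan 7.19, 2.63) remains open.

References: Bondy–Simonovits, JCTB 16 (1974) 97–105 (through `SoloInformedSumsetGirth`);
soloist notes `paper/quadspan.md` 2.59–2.67, `work/s35/s35.md` §3, `paper/sharpest.md` §9.15.
-/

namespace Summit.ValiantsHypothesis.ValiantsHypothesis.Theorems

open Finset Polynomial

/-- Subsets of `(K,h)`-free sets are `(K,h)`-free. -/
theorem SoloNatFree.anti {K h : ℕ} {E E' : Finset ℕ} (hE : SoloNatFree K h E) (hsub : E' ⊆ E) :
    SoloNatFree K h E' := by
  classical
  intro c hc hch hsum e he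
  set c' : ℕ → ℤ := fun x => if x ∈ E' then c x else 0 with hc'
  have hfil : (E.filter fun x => c' x ≠ 0) = E'.filter fun x => c x ≠ 0 := by
    ext x
    simp only [mem_filter, hc']
    constructor
    · rintro ⟨-, hx⟩
      by_cases hxE : x ∈ E'
      · rw [if_pos hxE] at hx; exact ⟨hxE, hx⟩
      · rw [if_neg hxE] at hx; exact (hx rfl).elim
    · rintro ⟨hxE, hx⟩
      exact ⟨hsub hxE, by rw [if_pos hxE]; exact hx⟩
  have h1 : (E.filter fun x => c' x ≠ 0).card ≤ K := by rw [hfil]; exact hc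
  have h2 : ∀ x, |c' x| ≤ h := by
    intro x; simp only [hc']; split_ifs
    · exact hch x
    · simp
  have h3 : (∑ x ∈ E, c' x * (x : ℤ)) = 0 := by
    have : (∑ x ∈ E, c' x * (x : ℤ)) = ∑ x ∈ E', c x * (x : ℤ) := by
      rw [← Finset.sum_subset hsub (f := fun x => c' x * (x : ℤ))]
      · apply Finset.sum_congr rfl
        intro x hx; simp only [hc', if_pos hx]
      · intro x _ hx; simp only [hc', if_neg hx, zero_mul]
    rw [this, hsum]
  have h4 := hE c' h1 h2 h3 e (hsub he)
  simp only [hc', if_pos he] at h4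
  exact h4

/-- In `ℕ∞`: if `↑n ≤ x` and `x + ↑m ≤ ↑(n + m)`, then `x = ↑n`. -/
theorem solo_enat_eq_of_le_of_add_le {x : ℕ∞} {n m : ℕ} (h1 : ((n : ℕ) : ℕ∞) ≤ x)
    (h2 : x + (m : ℕ∞) ≤ ((n + m : ℕ) : ℕ∞)) : x = (n : ℕ∞) := by
  have hx : x ≠ ⊤ := by
    intro h
    rw [h, top_add] at h2
    exact ENat.coe_ne_top _ (top_le_iff.mp h2)
  obtain ⟨y, rfl⟩ := ENat.ne_top_iff_exists.mp hx
  have h2' : y + m ≤ n + m := by exact_mod_cast h2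
  have h1' : n ≤ y := by exact_mod_cast h1
  have : y = n := by omega
  rw [this]

/-- **Ray girth bound** (quadspan 2.67; kernel form, s35).  Columns `u_i = (p i, q i)`, a probe
column `a`, `V ⊇` the column orders, `R ⊇` the contact profile `{ord det(u_a,u_x)}` of the probe.
If every `e ∈ E` is `X^e ∝ det(u_i,u_j)` for a pair whose branch class `C_i(e - μ_i - μ_j)`
contains `a`, and `E` is `(K,h)`-free with `4k ≤ K`, `1 ≤ k`, `1 ≤ h`, then
`|E| ≤ |R| + 86 k |V|^{1+1/k}`. -/
theorem soloInformed_rayGirth {F : Type*} [Field F] {L K h k : ℕ}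
    (hk : 1 ≤ k) (hK : 4 * k ≤ K) (hh : 1 ≤ h)
    (p q : Fin L → F[X]) (hcol : ∀ i, p i ≠ 0 ∨ q i ≠ 0)
    (V : Finset ℕ) (hV : ∀ i, soloBGm p q i ∈ V) (a : Fin L) (R : Finset ℕ)
    (hR : ∀ x : Fin L, soloBGdet p q a x ≠ 0 → (soloBGdet p q a x).natTrailingDegree ∈ R)
    (E : Finset ℕ)
    (hE : ∀ e ∈ E, ∃ i j : Fin L, ∃ θ : ℕ, ∃ c : F, c ≠ 0 ∧ p i * q j - p j * q i = C c * X ^ e ∧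
      θ + soloBGm p q i + soloBGm p q j = e ∧ a ∈ soloBGcl p q i θ)
    (hfree : SoloNatFree K h E) :
    (E.card : ℝ) ≤ R.card + 86 * k * (V.card : ℝ) ^ (1 + 1 / (k : ℝ)) := by
  classical
  -- Key step (Cramer ultrametric): `e + μ_a = ord det(u_a,u_z) + μ_y` with `{y,z} = {i,j}`.
  have key : ∀ e ∈ E, ∃ y z : Fin L, soloBGm p q y ≤ e ∧ soloBGdet p q a z ≠ 0 ∧
      (soloBGdet p q a z).natTrailingDegree + soloBGm p q y = e + soloBGm p q a := by
    intro e he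
    obtain ⟨i, j, θ, c, hc, hdet, hθ, hai⟩ := hE e he
    have hd : soloBGd p q i j = ((θ + soloBGm p q i + soloBGm p q j : ℕ) : ℕ∞) := by
      rw [hθ]; simp only [soloBGd, soloBGdet, hdet]; exact trailingDegree_C_mul_X_pow e hc
    have haj : a ∈ soloBGcl p q j θ := by rw [(solo_bg_split hcol hd).2]; exact hai
    rw [solo_bg_mem_cl] at hai haj
    rw [solo_bg_d_symm p q a j] at haj
    have hu := solo_bg_ultra p q i a j
    rw [← solo_bg_m_coe (hcol j), ← solo_bg_m_coe (hcol i), ← solo_bg_m_coe (hcol a), hd] at hu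
    -- finiteness and value of an order pinned between two equal bounds
    have pin : ∀ (z : Fin L) (n : ℕ), soloBGd p q a z = (n : ℕ∞) →
        soloBGdet p q a z ≠ 0 ∧ (soloBGdet p q a z).natTrailingDegree = n := by
      intro z n hz
      have hne : soloBGdet p q a z ≠ 0 := by
        intro h0
        simp only [soloBGd, h0, trailingDegree_zero] at hz
        exact ENat.top_ne_coe _ hz
      refine ⟨hne, ?_⟩
      have h2 : ((soloBGdet p q a z).natTrailingDegree : ℕ∞) = (n : ℕ∞) := by
        rw [← trailingDegree_eq_natTrailingDegree hne]; exact hz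
      exact_mod_cast h2
    rcases min_le_iff.mp hu with h1 | h1
    · -- `d(i,a) + μ_j = e + μ_a`
      have hsum : soloBGd p q i a + (soloBGm p q j : ℕ∞) ≤
          ((θ + soloBGm p q i + soloBGm p q a + soloBGm p q j : ℕ) : ℕ∞) := by
        calc soloBGd p q i a + (soloBGm p q j : ℕ∞)
            ≤ ((θ + soloBGm p q i + soloBGm p q j : ℕ) : ℕ∞) + (soloBGm p q a : ℕ∞) := h1
          _ = ((θ + soloBGm p q i + soloBGm p q a + soloBGm p q j : ℕ) : ℕ∞) := by
              push_cast; ring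
      have heq : soloBGd p q i a = ((θ + soloBGm p q i + soloBGm p q a : ℕ) : ℕ∞) :=
        solo_enat_eq_of_le_of_add_le hai hsum
      rw [solo_bg_d_symm p q a i] at heq
      obtain ⟨hne, hval⟩ := pin i _ heq
      exact ⟨j, i, by omega, hne, by omega⟩
    · -- `d(a,j) + μ_i = e + μ_a`
      have hsum : soloBGd p q a j + (soloBGm p q i : ℕ∞) ≤
          ((θ + soloBGm p q j + soloBGm p q a + soloBGm p q i : ℕ) : ℕ∞) := by
        calc soloBGd p q a j + (soloBGm p q i : ℕ∞)
            ≤ ((θ + soloBGm p q i + soloBGm p q j : ℕ) : ℕ∞) + (soloBGm p q a : ℕ∞) := h1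
          _ = ((θ + soloBGm p q j + soloBGm p q a + soloBGm p q i : ℕ) : ℕ∞) := by
              push_cast; ring
      have heq : soloBGd p q a j = ((θ + soloBGm p q j + soloBGm p q a : ℕ) : ℕ∞) :=
        solo_enat_eq_of_le_of_add_le haj hsum
      obtain ⟨hne, hval⟩ := pin j _ heq
      exact ⟨i, j, by omega, hne, by omega⟩
  haveI : Inhabited (Fin L) := ⟨a⟩
  choose! y z hy hz hyz using key
  set x : ℕ → ℕ := fun e => e - soloBGm p q (y e) with hx
  set v : ℕ → ℕ := fun e => soloBGm p q (y e) with hv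
  have hvV : ∀ e ∈ E, v e ∈ V := fun e _ => hV _
  have hxv : ∀ e ∈ E, x e + v e = e := by
    intro e he; have := hy e he; simp only [hx, hv]; omega
  have h1 := soloInformed_asymSumsetGirth hk hK hh E V x v hvV hxv hfree
  -- the `x`-values, shifted by `μ_a`, lie in the contact profile `R`
  have himg : (E.image x).card ≤ R.card := by
    have hinj : Function.Injective (fun t : ℕ => t + soloBGm p q a) := add_left_injective _
    rw [← card_image_of_injective (E.image x) hinj, image_image]
    apply card_le_card
    intro r hr
    rw [mem_image] at hr
    obtain ⟨e, he, rfl⟩ := hr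
    simp only [Function.comp, hx]
    have h3 := hyz e he
    have h4 := hy e he
    have : e - soloBGm p q (y e) + soloBGm p q a = (soloBGdet p q a (z e)).natTrailingDegree := by
      omega
    rw [this]
    exact hR _ (hz e he)
  have : ((E.image x).card : ℝ) ≤ R.card := by exact_mod_cast himg
  linarith

/-- **Ray girth bound in terms of the dimension** (quadspan 2.67).  If all entries `p i`, `q i`
lie in a subspace `W` with `dim W = s`, then for any probe column `a` the free target values whose
branch class contains `a` number at most `2s + 86 k s^{1+1/k}`: the contact profile of `a`
consists of orders of nonzero elements of `p_a W + q_a W`, of dimension `≤ 2s`. -/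
theorem soloInformed_rayGirth_finrank {F : Type*} [Field F] {L K h k : ℕ}
    (hk : 1 ≤ k) (hK : 4 * k ≤ K) (hh : 1 ≤ h) (W : Submodule F F[X]) [FiniteDimensional F W]
    (p q : Fin L → F[X]) (hpW : ∀ i, p i ∈ W) (hqW : ∀ i, q i ∈ W)
    (hcol : ∀ i, p i ≠ 0 ∨ q i ≠ 0) (a : Fin L) (E : Finset ℕ)
    (hE : ∀ e ∈ E, ∃ i j : Fin L, ∃ θ : ℕ, ∃ c : F, c ≠ 0 ∧ p i * q j - p j * q i = C c * X ^ e ∧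
      θ + soloBGm p q i + soloBGm p q j = e ∧ a ∈ soloBGcl p q i θ)
    (hfree : SoloNatFree K h E) :
    (E.card : ℝ) ≤ 2 * Module.finrank F W +
      86 * k * (Module.finrank F W : ℝ) ^ (1 + 1 / (k : ℝ)) := by
  classical
  set V : Finset ℕ := (univ : Finset (Fin L)).image (soloBGm p q) with hVdef
  have hV : ∀ i, soloBGm p q i ∈ V := fun i => mem_image_of_mem _ (mem_univ i)
  set R : Finset ℕ := ((univ : Finset (Fin L)).filter fun x => soloBGdet p q a x ≠ 0).image
    fun x => (soloBGdet p q a x).natTrailingDegree with hRdef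
  have hR : ∀ x : Fin L, soloBGdet p q a x ≠ 0 → (soloBGdet p q a x).natTrailingDegree ∈ R :=
    fun x hx0 => mem_image_of_mem _ (mem_filter.mpr ⟨mem_univ x, hx0⟩)
  have h1 := soloInformed_rayGirth hk hK hh p q hcol V hV a R hR E hE hfree
  -- `|V| ≤ dim W`
  have hrep : ∀ b ∈ V, ∃ f ∈ W, f ≠ 0 ∧ f.natTrailingDegree = b := by
    intro b hb
    rw [hVdef, mem_image] at hb
    obtain ⟨i, -, rfl⟩ := hb
    set f : F[X] := if (p i).trailingDegree ≤ (q i).trailingDegree then p i else q i with hf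
    have hfW : f ∈ W := by simp only [hf]; split_ifs <;> simp [hpW, hqW]
    have hμ : f.trailingDegree = soloBGmu p q i := by
      simp only [hf, soloBGmu]
      split_ifs with hc
      · exact (min_eq_left hc).symm
      · exact (min_eq_right (le_of_not_ge hc)).symm
    have hf0 : f ≠ 0 := fun h0 =>
      solo_bg_mu_ne_top (hcol i) (hμ.symm.trans (trailingDegree_eq_top.mpr h0))
    refine ⟨f, hfW, hf0, ?_⟩
    have h2 : (f.natTrailingDegree : ℕ∞) = (soloBGm p q i : ℕ∞) := by
      rw [← trailingDegree_eq_natTrailingDegree hf0, hμ, solo_bg_m_coe (hcol i)]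
    exact_mod_cast h2
  have hVcard : V.card ≤ Module.finrank F W := solo_card_le_finrank_of_orders W V hrep
  -- `|R| ≤ dim (p_a W + q_a W) ≤ 2 dim W`
  set U : Submodule F F[X] :=
    W.map (LinearMap.mulLeft F (p a)) ⊔ W.map (LinearMap.mulLeft F (q a)) with hUdef
  have hdetU : ∀ x, soloBGdet p q a x ∈ U := by
    intro x
    have h1' : p a * q x ∈ W.map (LinearMap.mulLeft F (p a)) :=
      Submodule.mem_map.mpr ⟨q x, hqW x, by rw [LinearMap.mulLeft_apply]⟩
    have h2' : p x * q a ∈ W.map (LinearMap.mulLeft F (q a)) :=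
      Submodule.mem_map.mpr ⟨p x, hpW x, by rw [LinearMap.mulLeft_apply, mul_comm]⟩
    simp only [soloBGdet]
    exact Submodule.sub_mem _ (Submodule.mem_sup_left h1') (Submodule.mem_sup_right h2')
  have hrepR : ∀ r ∈ R, ∃ f ∈ U, f ≠ 0 ∧ f.natTrailingDegree = r := by
    intro r hr
    rw [hRdef, mem_image] at hr
    obtain ⟨x, hx, rfl⟩ := hr
    exact ⟨_, hdetU x, (mem_filter.mp hx).2, rfl⟩
  have hRcard : R.card ≤ Module.finrank F U := solo_card_le_finrank_of_orders U R hrepR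
  have hU : Module.finrank F U ≤ 2 * Module.finrank F W := by
    have e1 := Submodule.finrank_sup_add_finrank_inf_eq
      (W.map (LinearMap.mulLeft F (p a))) (W.map (LinearMap.mulLeft F (q a)))
    have e2 := Submodule.finrank_map_le (LinearMap.mulLeft F (p a)) W
    have e3 := Submodule.finrank_map_le (LinearMap.mulLeft F (q a)) W
    rw [hUdef]
    omega
  have hRle : (R.card : ℝ) ≤ 2 * Module.finrank F W := by
    exact_mod_cast hRcard.trans hU
  have hpow : (V.card : ℝ) ^ (1 + 1 / (k : ℝ)) ≤ (Module.finrank F W : ℝ) ^ (1 + 1 / (k : ℝ)) :=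
    Real.rpow_le_rpow (by positivity) (by exact_mod_cast hVcard) (by positivity)
  have hk0 : (0 : ℝ) ≤ 86 * k := by positivity
  nlinarith [mul_le_mul_of_nonneg_left hpow hk0]

end Summit.ValiantsHypothesis.ValiantsHypothesis.Theorems
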